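import Summits.CriticalPhenomena.PercolationContinuityZ3.Theorems.PercNearOneGluingNoHeavyLowerTailSahiOneStepProfileGridCovariance
import HarnessLib

/-!
# THE PROFILE-GRID THEOREM: `(2′)` on a product of `PF₂` chains for an OR of coordinate thresholds

Prover prim-ineq-prove-3 gen 44 (`--supports stmt-CriticalPhenomena-4575`; memo
`run/shared/lean/prim/prim-ineq-prove-3/PROOF-G43-DISJOINT-OR.md`, simplified: no configuration-level coupling is needed).
Last of four files (see `…ProfileGridPrelim`, `…ProfileGridCoupling`, `…ProfileGridCovariance`).

**`grid_osN_nonneg`.**  Let `φ_j` (`j ∈ κ`) be `PF₂` probability weights on `{0,…,N}`, `Φ = Π φ_j`, `H = {Σ_j v_j ≥ t}`,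
`B = {∃ j, v_j ≥ r_j}`, and `u` a nonnegative numerator `≤ Φ` satisfying the one-coordinate cross inequalities (so `u = a·Φ`, `a`
non-decreasing).  Then the one-step functional `n` of the SahiOneStep programme is nonnegative in the five-term shape of `osN_ind_ind`:
`0 ≤ ⟨u1_H⟩⟨Φ1_{H∩B}⟩ + (1 − ⟨Φ1_H⟩)⟨u1_{H∩B}⟩ + ⟨Φ1_H⟩⟨u⟩⟨Φ1_B⟩ − ⟨u1_H⟩⟨Φ1_B⟩ − ⟨Φ1_{H∩B}⟩⟨u⟩`.
PROOF.  `cE` is the coupling expectation `Σ_θ Σ_ñ ρ(θ)λ(ñ)h(θ,ñ)`.  `coupling_main_ineq`: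
`E[a(W)1_L(W)]·(E[1_L(ñ)] − E[1_L(W)]) ≤ E[1_L(W)]·(E[a(W)] − E[a(ñ)1_H(ñ)] − E[a(W)1_L(W)])` — the transition criterion of gen 43
(`…SahiOneStepTransitionCoupling`) at the profile level: `ñ ≤ W`, `H(ñ) ⇒ H(W)`, and the covariance of `a(W)` and `1_H(W)` on
`{ñ ∈ L}` is `≥ 0` (`coupling_cov_nonneg`).  Substituting the marginals (`cE_cpl_ite`, `cE_low_ite`) the two sides are `d·K₀`-type
expressions in the eight cell masses of `{H,L} × {D,B}` (`d = Φ(D)`); `d > 0` cancels and `d = 0` is trivial.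
One definition (`cE`), no sorries.  The cube theorem is `…SahiOneStepDisjointOr`.
-/

namespace Summit.CriticalPhenomena.PercolationContinuityZ3.Theorems

namespace SahiOneStep

namespace ProfileGrid

open Finset Function
open Literature.Probability.Distributions (IsLogConcaveSeq piWeight blockSum laySum laySum_def efron_prefix_mul_le)
open Literature.Probability.LatticeModels.FKGEqualityChains (mix IsLogSupermodular cov cov_nonneg)

variable {κ : Type*} {N : ℕ}

/-! ## Small bookkeeping lemmas on `ite`-sums -/

section Split

variable [Fintype κ] [DecidableEq κ]

/-- Splitting a sum along a predicate. [folklore] -/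
theorem sum_split (f : (κ → Fin (N + 1)) → ℝ) (P : (κ → Fin (N + 1)) → Prop) [DecidablePred P] :
    ∑ v, f v = (∑ v, if P v then f v else 0) + ∑ v, if ¬ P v then f v else 0 := by
  rw [← sum_add_distrib]; exact Fintype.sum_congr _ _ fun v => by split_ifs <;> simp

/-- Splitting an `ite`-sum along a second predicate. [folklore] -/
theorem sum_ite_split (f : (κ → Fin (N + 1)) → ℝ) (P Q : (κ → Fin (N + 1)) → Prop) [DecidablePred P] [DecidablePred Q] :
    (∑ v, if P v then f v else 0) = (∑ v, if P v ∧ Q v then f v else 0) + ∑ v, if P v ∧ ¬ Q v then f v else 0 := by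
  rw [← sum_add_distrib]
  exact Fintype.sum_congr _ _ fun v => by by_cases h1 : P v <;> by_cases h2 : Q v <;> simp [h1, h2]

end Split

/-- `B = {∃ j, r_j ≤ v_j}` is the complement of the box `D = {∀ j, v_j < r_j}`. [folklore] -/
theorem exists_le_iff_not_forall_lt (r : κ → ℕ) (v : κ → Fin (N + 1)) :
    (∃ j, r j ≤ (v j : ℕ)) ↔ ¬ ∀ j, (v j : ℕ) < r j := by
  simp only [not_forall, not_lt]

/-! ## The coupling expectation `E[h(θ, ñ)] = Σ_θ Σ_ñ ρ(θ) λ(ñ) h(θ, ñ)` -/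

section CE

variable [Fintype κ] [DecidableEq κ]

/-- The (unnormalised) coupling expectation `E[h] = Σ_θ Σ_ñ ρ(θ)·λ(ñ)·h(θ, ñ)`. [this work] -/
def cE (N : ℕ) (φ : κ → ℕ → ℝ) (r : κ → ℕ) (h : (κ → Fin (N + 2)) → (κ → Fin (N + 1)) → ℝ) : ℝ :=
  ∑ θ : κ → Fin (N + 2), ∑ ñ : κ → Fin (N + 1), rho N φ r θ * piWeight N (loW φ r) ñ * h θ ñ

variable (φ : κ → ℕ → ℝ) (r : κ → ℕ)

/-- `E` of a pointwise-nonnegative integrand is nonnegative. [this work] -/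
theorem cE_nonneg (hφ0 : ∀ j n, 0 ≤ φ j n) {h : (κ → Fin (N + 2)) → (κ → Fin (N + 1)) → ℝ} (hh : ∀ θ ñ, 0 ≤ h θ ñ) :
    0 ≤ cE N φ r h :=
  sum_nonneg fun θ _ => sum_nonneg fun ñ _ =>
    mul_nonneg (mul_nonneg (rho_nonneg φ r hφ0 θ) (piWeight_nonneg (fun j n => loW_nonneg φ r hφ0 j n) ñ)) (hh θ ñ)

/-- `E` is additive. [this work] -/
theorem cE_add (h h' : (κ → Fin (N + 2)) → (κ → Fin (N + 1)) → ℝ) :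
    cE N φ r (fun θ ñ => h θ ñ + h' θ ñ) = cE N φ r h + cE N φ r h' := by
  unfold cE; rw [← sum_add_distrib]
  exact Fintype.sum_congr _ _ fun θ => by rw [← sum_add_distrib]; exact Fintype.sum_congr _ _ fun ñ => by ring

/-- `E` respects subtraction. [this work] -/
theorem cE_sub (h h' : (κ → Fin (N + 2)) → (κ → Fin (N + 1)) → ℝ) :
    cE N φ r (fun θ ñ => h θ ñ - h' θ ñ) = cE N φ r h - cE N φ r h' := by
  unfold cE; rw [← sum_sub_distrib]
  exact Fintype.sum_congr _ _ fun θ => by rw [← sum_sub_distrib]; exact Fintype.sum_congr _ _ fun ñ => by ring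

/-- `E` depends only on the integrand (pointwise). [this work] -/
theorem cE_congr {h h' : (κ → Fin (N + 2)) → (κ → Fin (N + 1)) → ℝ} (hh : ∀ θ ñ, h θ ñ = h' θ ñ) :
    cE N φ r h = cE N φ r h' := by
  unfold cE; exact Fintype.sum_congr _ _ fun θ => Fintype.sum_congr _ _ fun ñ => by rw [hh]

/-- `E` of an indicator-weighted function of the coupled count `W` (marginal `d·Φ`). [this work] -/
theorem cE_cpl_ite (P : (κ → Fin (N + 1)) → Prop) [DecidablePred P] (g : (κ → Fin (N + 1)) → ℝ) :
    cE N φ r (fun θ ñ => if P (cpl θ ñ) then g (cpl θ ñ) else 0) =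
      (∏ j, loMass N φ r j) * ∑ v : κ → Fin (N + 1), if P v then piWeight N φ v * g v else 0 := by
  have := sum_rho_lo_cpl φ r (fun v => if P v then g v else 0)
  unfold cE
  rw [this]
  congr 1
  exact Fintype.sum_congr _ _ fun v => by split_ifs <;> simp

/-- `E` of a function of the coupled count `W`. [this work] -/
theorem cE_cpl (g : (κ → Fin (N + 1)) → ℝ) :
    cE N φ r (fun θ ñ => g (cpl θ ñ)) = (∏ j, loMass N φ r j) * ∑ v : κ → Fin (N + 1), piWeight N φ v * g v :=
  sum_rho_lo_cpl φ r g

/-- `E` of an indicator-weighted function of the low sample `ñ` (marginal `Φ` on the box `D`). [this work] -/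
theorem cE_low_ite (P : (κ → Fin (N + 1)) → Prop) [DecidablePred P] (k : (κ → Fin (N + 1)) → ℝ) :
    cE N φ r (fun _ ñ => if P ñ then k ñ else 0) =
      (∏ j, ∑ n : Fin (N + 1), φ j n) *
        ∑ v : κ → Fin (N + 1), if P v ∧ (∀ j, (v j : ℕ) < r j) then piWeight N φ v * k v else 0 := by
  have := sum_rho_lo_low φ r (fun v => if P v then k v else 0)
  unfold cE
  rw [this]
  congr 1
  exact Fintype.sum_congr _ _ fun v => by
    by_cases h1 : P v <;> by_cases h2 : ∀ j, (v j : ℕ) < r j <;> simp [h1, h2]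

/-- `E` restricted to the lower ball in `ñ` is the `ρ`-average of the tilted low functional `γ`. [this work] -/
theorem cE_eq_sum_gam (t : ℕ) (k : (κ → Fin (N + 2)) → (κ → Fin (N + 1)) → ℝ) :
    cE N φ r (fun θ ñ => if ¬ t ≤ blockSum univ ñ then k θ ñ else 0) =
      ∑ θ : κ → Fin (N + 2), rho N φ r θ * gam N φ r t (k θ) := by
  unfold cE gam
  refine Fintype.sum_congr _ _ fun θ => ?_
  rw [mul_sum]
  exact Fintype.sum_congr _ _ fun ñ => by simp only [not_le]; ring

/-! ## The coupling inequality (criterion + covariance) at the level of `E` -/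

/-- **The coupling inequality.**  For a non-decreasing `a` (write `W` for the coupled count, `L = {Σ < t}`, `H = Lᶜ`):
`E[a(W)1_L(W)] · (E[1_L(ñ)] − E[1_L(W)]) ≤ E[1_L(W)] · (E[a(W)] − E[a(ñ)1_H(ñ)] − E[a(W)1_L(W)])`.
Ingredients: `ñ ≤ W` pointwise (so `H(ñ) ⇒ H(W)`), and the nonnegative covariance of `a(W)` and `1_H(W)` on `{ñ ∈ L}`
(`coupling_cov_nonneg`). [this work] -/
theorem coupling_main_ineq (hφ : ∀ j, IsLogConcaveSeq (φ j)) (hφ1 : ∀ j, ∑ n : Fin (N + 1), φ j n = 1) (t : ℕ)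
    {a : (κ → Fin (N + 1)) → ℝ} (ha : Monotone a) :
    cE N φ r (fun θ ñ => if ¬ t ≤ blockSum univ (cpl θ ñ) then a (cpl θ ñ) else 0) *
        (cE N φ r (fun _ ñ => if ¬ t ≤ blockSum univ ñ then (1 : ℝ) else 0) -
          cE N φ r (fun θ ñ => if ¬ t ≤ blockSum univ (cpl θ ñ) then (1 : ℝ) else 0)) ≤
      cE N φ r (fun θ ñ => if ¬ t ≤ blockSum univ (cpl θ ñ) then (1 : ℝ) else 0) *
        (cE N φ r (fun θ ñ => a (cpl θ ñ)) - cE N φ r (fun _ ñ => if t ≤ blockSum univ ñ then a ñ else 0) -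
          cE N φ r (fun θ ñ => if ¬ t ≤ blockSum univ (cpl θ ñ) then a (cpl θ ñ) else 0)) := by
  have hφ0 : ∀ j n, 0 ≤ φ j n := fun j => (hφ j).1
  have hHmono : ∀ (θ : κ → Fin (N + 2)) (ñ : κ → Fin (N + 1)), t ≤ blockSum univ ñ → t ≤ blockSum univ (cpl θ ñ) :=
    fun θ ñ h => h.trans (sum_le_sum fun j _ => by exact_mod_cast (le_cpl θ ñ) j)
  -- the two-dimensional quantities
  obtain ⟨X, hX⟩ : ∃ X : ℝ, cE N φ r (fun θ ñ => if ¬ t ≤ blockSum univ ñ then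
      (if t ≤ blockSum univ (cpl θ ñ) then a (cpl θ ñ) else 0) else 0) = X := ⟨_, rfl⟩
  obtain ⟨Y, hY⟩ : ∃ Y : ℝ, cE N φ r (fun θ ñ => if ¬ t ≤ blockSum univ ñ then
      (if t ≤ blockSum univ (cpl θ ñ) then (1 : ℝ) else 0) else 0) = Y := ⟨_, rfl⟩
  obtain ⟨P, hP⟩ : ∃ P : ℝ, cE N φ r (fun θ ñ => if ¬ t ≤ blockSum univ ñ then
      (if ¬ t ≤ blockSum univ (cpl θ ñ) then a (cpl θ ñ) else 0) else 0) = P := ⟨_, rfl⟩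
  obtain ⟨Q, hQ⟩ : ∃ Q : ℝ, cE N φ r (fun θ ñ => if ¬ t ≤ blockSum univ ñ then
      (if ¬ t ≤ blockSum univ (cpl θ ñ) then (1 : ℝ) else 0) else 0) = Q := ⟨_, rfl⟩
  have hQ0 : 0 ≤ Q := by rw [← hQ]; exact cE_nonneg φ r hφ0 fun θ ñ => by split_ifs <;> norm_num
  -- (P3), (P4): `1_L(W) = 1_L(ñ) 1_L(W)`
  have eQ : cE N φ r (fun θ ñ => if ¬ t ≤ blockSum univ (cpl θ ñ) then (1 : ℝ) else 0) = Q := by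
    rw [← hQ]; refine cE_congr φ r fun θ ñ => ?_
    by_cases h1 : t ≤ blockSum univ ñ
    · rw [if_neg (not_not.2 (hHmono θ ñ h1)), if_neg (not_not.2 h1)]
    · rw [if_pos h1]
  have eP : cE N φ r (fun θ ñ => if ¬ t ≤ blockSum univ (cpl θ ñ) then a (cpl θ ñ) else 0) = P := by
    rw [← hP]; refine cE_congr φ r fun θ ñ => ?_
    by_cases h1 : t ≤ blockSum univ ñ
    · rw [if_neg (not_not.2 (hHmono θ ñ h1)), if_neg (not_not.2 h1)]
    · rw [if_pos h1]
  -- (P2): `1_L(ñ) − 1_L(W) = 1_L(ñ) 1_H(W)`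
  have eY : cE N φ r (fun _ ñ => if ¬ t ≤ blockSum univ ñ then (1 : ℝ) else 0) -
      cE N φ r (fun θ ñ => if ¬ t ≤ blockSum univ (cpl θ ñ) then (1 : ℝ) else 0) = Y := by
    rw [← cE_sub, ← hY]; refine cE_congr φ r fun θ ñ => ?_
    by_cases h1 : t ≤ blockSum univ ñ
    · rw [if_neg (not_not.2 h1), if_neg (not_not.2 (hHmono θ ñ h1)), if_neg (not_not.2 h1), sub_zero]
    · rw [if_pos h1, if_pos h1]; split_ifs <;> norm_num
  -- (P1): `E[a(W)] − E[a(ñ)1_H(ñ)] − E[a(W)1_L(W)] − X = E[(a(W) − a(ñ)) 1_H(ñ)] ≥ 0`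
  have eX : X ≤ cE N φ r (fun θ ñ => a (cpl θ ñ)) - cE N φ r (fun _ ñ => if t ≤ blockSum univ ñ then a ñ else 0) -
      cE N φ r (fun θ ñ => if ¬ t ≤ blockSum univ (cpl θ ñ) then a (cpl θ ñ) else 0) := by
    rw [← hX, ← sub_nonneg, ← cE_sub, ← cE_sub, ← cE_sub]
    refine cE_nonneg φ r hφ0 fun θ ñ => ?_
    by_cases h1 : t ≤ blockSum univ ñ
    · rw [if_pos h1, if_neg (not_not.2 (hHmono θ ñ h1)), if_neg (not_not.2 h1), sub_zero, sub_zero, sub_nonneg]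
      exact ha (le_cpl θ ñ)
    · rw [if_neg h1, if_pos h1, sub_zero]
      split_ifs <;> linarith
  -- (Ω): `P · Y ≤ Q · X` from the covariance inequality
  have eΩ : P * Y ≤ Q * X := by
    have hcov := coupling_cov_nonneg φ hφ r t ha
    have hR1 : ∏ j, ∑ n : Fin (N + 1), φ j n = 1 := by rw [prod_congr rfl fun j _ => hφ1 j]; simp
    have hR : ∑ θ : κ → Fin (N + 2), rho N φ r θ = 1 := by rw [sum_rho φ r, hR1]
    rw [hR, one_mul] at hcov
    have i1 : ∑ θ : κ → Fin (N + 2), rho N φ r θ * gam N φ r t (fun ñ => a (cpl θ ñ)) = P + X := by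
      rw [← cE_eq_sum_gam φ r t (fun θ ñ => a (cpl θ ñ)), ← hP, ← hX, ← cE_add]
      exact cE_congr φ r fun θ ñ => by split_ifs <;> ring
    have i2 : ∑ θ : κ → Fin (N + 2), rho N φ r θ *
        gam N φ r t (fun ñ => if t ≤ blockSum univ (cpl θ ñ) then (1 : ℝ) else 0) = Y := by
      rw [← cE_eq_sum_gam φ r t (fun θ ñ => if t ≤ blockSum univ (cpl θ ñ) then (1 : ℝ) else 0), ← hY]
    have i3 : ∑ θ : κ → Fin (N + 2), rho N φ r θ *
        gam N φ r t (fun ñ => a (cpl θ ñ) * if t ≤ blockSum univ (cpl θ ñ) then (1 : ℝ) else 0) = X := by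
      rw [← cE_eq_sum_gam φ r t (fun θ ñ => a (cpl θ ñ) * if t ≤ blockSum univ (cpl θ ñ) then (1 : ℝ) else 0), ← hX]
      exact cE_congr φ r fun θ ñ => by split_ifs <;> ring
    have i4 : gam N φ r t (fun _ => 1) = Q + Y := by
      have h1 : gam N φ r t (fun _ => (1 : ℝ)) = ∑ θ : κ → Fin (N + 2), rho N φ r θ * gam N φ r t (fun _ => 1) := by
        rw [← sum_mul, hR, one_mul]
      rw [h1, ← cE_eq_sum_gam φ r t (fun _ _ => (1 : ℝ)), ← hQ, ← hY, ← cE_add]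
      exact cE_congr φ r fun θ ñ => by split_ifs <;> norm_num
    rw [i1, i2, i3, i4] at hcov
    have e : P * Y = (P + X) * Y - X * Y := by ring
    rw [e]
    linarith [hcov]
  -- combine
  have eX' : X ≤ cE N φ r (fun θ ñ => a (cpl θ ñ)) - cE N φ r (fun _ ñ => if t ≤ blockSum univ ñ then a ñ else 0) - P := by
    rw [← eP]; exact eX
  rw [eP, eY, eQ]
  exact eΩ.trans (mul_le_mul_of_nonneg_left eX' hQ0)

end CE

/-! ## The grid theorem -/

section Main

variable [Fintype κ] [DecidableEq κ]

/-- **THE GRID THEOREM (profile form of `(2′)` for an OR of coordinate thresholds).**  Let `φ_j` (`j ∈ κ`) be `PF₂` probability weights on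
`{0,…,N}` (independent block counts), `Φ = Π_j φ_j` the product weight, `H = {Σ_j v_j ≥ t}` the Hamming-threshold slot, and
`B = {∃ j, v_j ≥ r_j}` an OR of coordinate thresholds.  Let `u ≥ 0`, `u ≤ Φ`, satisfy the one-coordinate cross inequalities
`u(v with v_j:=x)·φ_j(x') ≤ u(v with v_j:=x')·φ_j(x)` (`x ≤ x'`) — i.e. `u = a·Φ` with `a` non-decreasing (`exists_monotone_density`).  Then the
one-step functional `n(a, 1_B)` at the slot `H` is nonnegative, written in the five-term shape of `osN_ind_ind`:
`0 ≤ ⟨u1_H⟩⟨Φ1_{H∩B}⟩ + (1 − ⟨Φ1_H⟩)⟨u1_{H∩B}⟩ + ⟨Φ1_H⟩⟨u⟩⟨Φ1_B⟩ − ⟨u1_H⟩⟨Φ1_B⟩ − ⟨Φ1_{H∩B}⟩⟨u⟩`.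
PROOF: the coupling `(θ, ñ) ↦ (ñ, W)` of `Φ(·|D)` and `Φ` (`D = Bᶜ`) and `coupling_main_ineq`; the box mass `d = Φ(D)` cancels
(and `d = 0` is trivial). [this work] -/
theorem grid_osN_nonneg (φ : κ → ℕ → ℝ) (hφ : ∀ j, IsLogConcaveSeq (φ j)) (hφ1 : ∀ j, ∑ n : Fin (N + 1), φ j n = 1)
    (r : κ → ℕ) (t : ℕ) (u : (κ → Fin (N + 1)) → ℝ) (hu0 : ∀ v, 0 ≤ u v) (huΦ : ∀ v, u v ≤ piWeight N φ v)
    (hmono : ∀ v j (x x' : Fin (N + 1)), x ≤ x' → u (update v j x) * φ j x' ≤ u (update v j x') * φ j x) :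
    0 ≤ (∑ v : κ → Fin (N + 1), if t ≤ blockSum univ v then u v else 0) *
          (∑ v : κ → Fin (N + 1), if t ≤ blockSum univ v ∧ (∃ j, r j ≤ (v j : ℕ)) then piWeight N φ v else 0)
      + (1 - ∑ v : κ → Fin (N + 1), if t ≤ blockSum univ v then piWeight N φ v else 0) *
          (∑ v : κ → Fin (N + 1), if t ≤ blockSum univ v ∧ (∃ j, r j ≤ (v j : ℕ)) then u v else 0)
      + (∑ v : κ → Fin (N + 1), if t ≤ blockSum univ v then piWeight N φ v else 0) * (∑ v : κ → Fin (N + 1), u v) *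
          (∑ v : κ → Fin (N + 1), if (∃ j, r j ≤ (v j : ℕ)) then piWeight N φ v else 0)
      - (∑ v : κ → Fin (N + 1), if t ≤ blockSum univ v then u v else 0) *
          (∑ v : κ → Fin (N + 1), if (∃ j, r j ≤ (v j : ℕ)) then piWeight N φ v else 0)
      - (∑ v : κ → Fin (N + 1), if t ≤ blockSum univ v ∧ (∃ j, r j ≤ (v j : ℕ)) then piWeight N φ v else 0) *
          (∑ v : κ → Fin (N + 1), u v) := by
  have hφ0 : ∀ j n, 0 ≤ φ j n := fun j => (hφ j).1
  obtain ⟨a, ha, ha0, hua⟩ := exists_monotone_density hφ0 u hu0 huΦ hmono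
  have hu' : ∀ v, u v = piWeight N φ v * a v := fun v => by rw [hua v, mul_comm]
  have hBD : ∀ v : κ → Fin (N + 1), (∃ j, r j ≤ (v j : ℕ)) ↔ ¬ ∀ j, (v j : ℕ) < r j :=
    fun v => exists_le_iff_not_forall_lt r v
  -- the eight atoms (masses / `a`-masses of the four cells `{H,L} × {D,B}`)
  obtain ⟨mHD, hmHD⟩ : ∃ x : ℝ, (∑ v : κ → Fin (N + 1),
    if t ≤ blockSum univ v ∧ (∀ j, (v j : ℕ) < r j) then piWeight N φ v else 0) = x := ⟨_, rfl⟩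
  obtain ⟨mHB, hmHB⟩ : ∃ x : ℝ, (∑ v : κ → Fin (N + 1),
    if t ≤ blockSum univ v ∧ ¬ (∀ j, (v j : ℕ) < r j) then piWeight N φ v else 0) = x := ⟨_, rfl⟩
  obtain ⟨mLD, hmLD⟩ : ∃ x : ℝ, (∑ v : κ → Fin (N + 1),
    if ¬ t ≤ blockSum univ v ∧ (∀ j, (v j : ℕ) < r j) then piWeight N φ v else 0) = x := ⟨_, rfl⟩
  obtain ⟨mLB, hmLB⟩ : ∃ x : ℝ, (∑ v : κ → Fin (N + 1),
    if ¬ t ≤ blockSum univ v ∧ ¬ (∀ j, (v j : ℕ) < r j) then piWeight N φ v else 0) = x := ⟨_, rfl⟩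
  obtain ⟨aHD, haHD⟩ : ∃ x : ℝ, (∑ v : κ → Fin (N + 1),
    if t ≤ blockSum univ v ∧ (∀ j, (v j : ℕ) < r j) then piWeight N φ v * a v else 0) = x := ⟨_, rfl⟩
  obtain ⟨aHB, haHB⟩ : ∃ x : ℝ, (∑ v : κ → Fin (N + 1),
    if t ≤ blockSum univ v ∧ ¬ (∀ j, (v j : ℕ) < r j) then piWeight N φ v * a v else 0) = x := ⟨_, rfl⟩
  obtain ⟨aLD, haLD⟩ : ∃ x : ℝ, (∑ v : κ → Fin (N + 1),
    if ¬ t ≤ blockSum univ v ∧ (∀ j, (v j : ℕ) < r j) then piWeight N φ v * a v else 0) = x := ⟨_, rfl⟩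
  obtain ⟨aLB, haLB⟩ : ∃ x : ℝ, (∑ v : κ → Fin (N + 1),
    if ¬ t ≤ blockSum univ v ∧ ¬ (∀ j, (v j : ℕ) < r j) then piWeight N φ v * a v else 0) = x := ⟨_, rfl⟩
  -- signs and `aD ≤ mD`
  have hmHD0 : 0 ≤ mHD := by
    rw [← hmHD]; exact sum_nonneg fun v _ => by split_ifs <;> [exact piWeight_nonneg hφ0 v; exact le_rfl]
  have hmLD0 : 0 ≤ mLD := by
    rw [← hmLD]; exact sum_nonneg fun v _ => by split_ifs <;> [exact piWeight_nonneg hφ0 v; exact le_rfl]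
  have hmLB0 : 0 ≤ mLB := by
    rw [← hmLB]; exact sum_nonneg fun v _ => by split_ifs <;> [exact piWeight_nonneg hφ0 v; exact le_rfl]
  have haHD0 : 0 ≤ aHD := by
    rw [← haHD]
    exact sum_nonneg fun v _ => by split_ifs <;> [exact mul_nonneg (piWeight_nonneg hφ0 v) (ha0 v); exact le_rfl]
  have haLD0 : 0 ≤ aLD := by
    rw [← haLD]
    exact sum_nonneg fun v _ => by split_ifs <;> [exact mul_nonneg (piWeight_nonneg hφ0 v) (ha0 v); exact le_rfl]
  have haLB0 : 0 ≤ aLB := by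
    rw [← haLB]
    exact sum_nonneg fun v _ => by split_ifs <;> [exact mul_nonneg (piWeight_nonneg hφ0 v) (ha0 v); exact le_rfl]
  have haHDle : aHD ≤ mHD := by
    rw [← haHD, ← hmHD]
    refine sum_le_sum fun v _ => ?_
    split_ifs
    · have := huΦ v; rw [hu'] at this; exact this
    · exact le_rfl
  have haLDle : aLD ≤ mLD := by
    rw [← haLD, ← hmLD]
    refine sum_le_sum fun v _ => ?_
    split_ifs
    · have := huΦ v; rw [hu'] at this; exact this
    · exact le_rfl
  -- the seven sums of the statement
  have s1 : (∑ v : κ → Fin (N + 1), if t ≤ blockSum univ v then u v else 0) = aHD + aHB := by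
    simp only [hu']; rw [sum_ite_split _ _ (fun v => ∀ j, (v j : ℕ) < r j), haHD, haHB]
  have s2 : (∑ v : κ → Fin (N + 1), if t ≤ blockSum univ v ∧ (∃ j, r j ≤ (v j : ℕ)) then piWeight N φ v else 0) = mHB := by
    rw [← hmHB]; exact Fintype.sum_congr _ _ fun v => by simp only [hBD]
  have s3 : (∑ v : κ → Fin (N + 1), if t ≤ blockSum univ v then piWeight N φ v else 0) = mHD + mHB := by
    rw [sum_ite_split _ _ (fun v => ∀ j, (v j : ℕ) < r j), hmHD, hmHB]
  have s4 : (∑ v : κ → Fin (N + 1), if t ≤ blockSum univ v ∧ (∃ j, r j ≤ (v j : ℕ)) then u v else 0) = aHB := by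
    rw [← haHB]; exact Fintype.sum_congr _ _ fun v => by simp only [hBD, hu']
  have s5 : (∑ v : κ → Fin (N + 1), u v) = aHD + aHB + aLD + aLB := by
    rw [sum_split u (fun v => t ≤ blockSum univ v), s1]
    simp only [hu']
    rw [sum_ite_split _ _ (fun v => ∀ j, (v j : ℕ) < r j), haLD, haLB]; ring
  have s6 : (∑ v : κ → Fin (N + 1), if (∃ j, r j ≤ (v j : ℕ)) then piWeight N φ v else 0) = mHB + mLB := by
    rw [sum_ite_split _ _ (fun v => t ≤ blockSum univ v), ← hmHB, ← hmLB]
    congr 1 <;> exact Fintype.sum_congr _ _ fun v => by simp only [hBD, and_comm]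
  have htot : ∑ v : κ → Fin (N + 1), piWeight N φ v = 1 := by
    have e := Fintype.prod_sum (fun j (n : Fin (N + 1)) => φ j (n : ℕ))
    unfold piWeight; rw [← e, prod_congr rfl fun j _ => hφ1 j]; simp
  have s7 : mHD + mHB + mLD + mLB = 1 := by
    rw [← htot, sum_split (piWeight N φ) (fun v => t ≤ blockSum univ v),
      sum_ite_split _ (fun v => t ≤ blockSum univ v) (fun v => ∀ j, (v j : ℕ) < r j),
      sum_ite_split _ (fun v => ¬ t ≤ blockSum univ v) (fun v => ∀ j, (v j : ℕ) < r j), hmHD, hmHB, hmLD, hmLB]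
    ring
  rw [s1, s2, s3, s4, s5, s6]
  -- the box mass `d = Φ(D) = mHD + mLD` and the marginals of the coupling
  have hdD : ∏ j, loMass N φ r j = mHD + mLD := by
    rw [← sum_box_eq_prod_loMass φ r, sum_split _ (fun v => t ≤ blockSum univ v), ← hmHD, ← hmLD]
    congr 1 <;> exact Fintype.sum_congr _ _ fun v => by
      by_cases h1 : t ≤ blockSum univ v <;> by_cases h2 : (∀ j, (v j : ℕ) < r j) <;> simp [h1, h2]
  have hR1 : ∏ j, ∑ n : Fin (N + 1), φ j n = 1 := by rw [prod_congr rfl fun j _ => hφ1 j]; simp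
  have eLW : cE N φ r (fun θ ñ => if ¬ t ≤ blockSum univ (cpl θ ñ) then (1 : ℝ) else 0) = (mHD + mLD) * (mLD + mLB) := by
    rw [cE_cpl_ite φ r (fun v => ¬ t ≤ blockSum univ v) (fun _ => 1), hdD,
      sum_ite_split _ _ (fun v => ∀ j, (v j : ℕ) < r j), ← hmLD, ← hmLB]
    simp only [mul_one]
  have eAW : cE N φ r (fun θ ñ => a (cpl θ ñ)) = (mHD + mLD) * (aHD + aHB + aLD + aLB) := by
    rw [cE_cpl φ r a, hdD, sum_split _ (fun v => t ≤ blockSum univ v),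
      sum_ite_split _ (fun v => t ≤ blockSum univ v) (fun v => ∀ j, (v j : ℕ) < r j),
      sum_ite_split _ (fun v => ¬ t ≤ blockSum univ v) (fun v => ∀ j, (v j : ℕ) < r j), haHD, haHB, haLD, haLB]
    ring
  have eALW : cE N φ r (fun θ ñ => if ¬ t ≤ blockSum univ (cpl θ ñ) then a (cpl θ ñ) else 0) =
      (mHD + mLD) * (aLD + aLB) := by
    rw [cE_cpl_ite φ r (fun v => ¬ t ≤ blockSum univ v) a, hdD,
      sum_ite_split _ _ (fun v => ∀ j, (v j : ℕ) < r j), haLD, haLB]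
  have eAHn : cE N φ r (fun _ ñ => if t ≤ blockSum univ ñ then a ñ else 0) = aHD := by
    rw [cE_low_ite φ r (fun v => t ≤ blockSum univ v) a, hR1, one_mul, haHD]
  have eLn : cE N φ r (fun _ ñ => if ¬ t ≤ blockSum univ ñ then (1 : ℝ) else 0) = mLD := by
    rw [cE_low_ite φ r (fun v => ¬ t ≤ blockSum univ v) (fun _ => 1), hR1, one_mul, ← hmLD]
    simp only [mul_one]
  -- the coupling inequality, in atoms
  have cm := coupling_main_ineq φ r hφ hφ1 t ha
  rw [eLW, eAW, eALW, eAHn, eLn] at cm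
  -- `d · K₀ ≥ 0`
  have key : 0 ≤ (mHD + mLD) * ((mLD + mLB) * ((mHD + mLD) * (aHD + aHB + aLD + aLB) - aHD) - (aLD + aLB) * mLD) := by
    nlinarith [cm]
  have ident : (aHD + aHB) * mHB + (1 - (mHD + mHB)) * aHB + (mHD + mHB) * (aHD + aHB + aLD + aLB) * (mHB + mLB)
      - (aHD + aHB) * (mHB + mLB) - mHB * (aHD + aHB + aLD + aLB) =
      (mLD + mLB) * ((mHD + mLD) * (aHD + aHB + aLD + aLB) - aHD) - (aLD + aLB) * mLD := by
    have hmLB : mLB = 1 - mHD - mHB - mLD := by linarith [s7]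
    rw [hmLB]; ring
  rw [ident]
  rcases (add_nonneg hmHD0 hmLD0).lt_or_eq with hdpos | hdzero
  · exact nonneg_of_mul_nonneg_right key hdpos
  · -- `d = 0`: the box `D` is null, `mHD = mLD = aHD = aLD = 0`
    have h1 : mHD = 0 := by linarith
    have h2 : mLD = 0 := by linarith
    have h3 : aHD = 0 := by linarith
    have h4 : aLD = 0 := by linarith
    rw [h1, h2, h3, h4]; ring_nf; exact le_rfl

end Main

end ProfileGrid

end SahiOneStep

end Summit.CriticalPhenomena.PercolationContinuityZ3.Theorems
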